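import Summits.QuantumFields.YangMills.Theorems.BalabanUVNodesK0S5NearCentredAnyLevel
import Summits.QuantumFields.YangMills.Theorems.BalabanUVNodesK0S5CollarMeetFamily
import Literature.MathematicalPhysics.QuantumFieldTheory.Balaban1983to89.Node00.DomainsMeet
import Literature.MathematicalPhysics.QuantumFieldTheory.Balaban1983to89.Node00.DomainsOfSeq
import HarnessLib

/-!
# K0⁷ `stub_prop8StepCoP13` (stmt-QuantumFields-20541), sub-target S5 — **THE S5 JUNCTION AT PRINT's (150) FAMILY, THE MEET `cubeDomains ⊓ domainsOfSeq Ω`** (dag-n07-e's 44B ∕ 44C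
# `Node00.domainsMeet` p614106 ∕ `Node00.domainsOfSeq` p615562): [Balaban1985Variational] p. 301 (150) «Ω′_j = □_j, j < k, Ω′_k = □″_k = □_k ∩ Ω_k» at a boundary datum IS the levelwise
# meet of the cube tower with the record's family (n07-e ANSWER Q-CUBE-TOP, INBOX ≈30725); this file supplies BY NAME the three S5 binders of the `HB` door there — the height, the
# inclusion `hbelow` of `K0S5CollarMeetFamily` («□_i ⊆ □̃ ⊆ Ω_{k−1} ⊆ Ω_i» from the HEAD's collar), the window's top membership `hY` («□ ⊆ Ω_k», the HEAD's placement) — and files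
# the door itself: FILE 5's `letters10On_HB_boxWindow_of_centred_nearClassW` at `D″` with p615101's `hcollar_of_not_near`, modulo `Adm22 D″` (dag-n07-w6 INTENT-9
# `adm22_meet_domainsOfSeq_seqOfRecord`), the data and the `ker Q` transfer

Cell `pub-ymgap`, width seat `pub-ymgap-k0-s1-w3` gen 5 (HUMAN RULING D-0149; START LIST v11 §k0-s1; bus CLAIM-6 of g5, trigger (t2) of this seat's HANDOFF met by p614106 ∕ p615562).
`--kind proof --supports stmt-QuantumFields-20541 --as helper`; count-neutral; def-free; nothing restated (`domainsMeet_k` ∕ `mem_domainsMeet_Om`, `domainsOfSeq_k` ∕ `mem_domainsOfSeq_Om_iff` ∕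
`inOm_domainsOfSeq_iff`, 39b `inOm_top_cubeDomains_of_mem_box`, V1 `Domains.inOm_of_le`, p615101 `hcollar_of_not_near`, FILE 5 §3 BY NAME).

WHY ∕ STATUS OF THE ROAD (n07-e g20, 08:16Z: ALIGNMENT with ME #35 ∕ FINDING A ∕ WORD-359b).  Print's per-cube family at a boundary datum is the PLAIN meet (permanent); under today's
inclusive record fibre (reading (b)) the `ker Q` transfer would want an interim SHRUNK meet — HELD (n07-e (δ) priority order), and NOT S5-compatible (this seat's LOCATED-SHRINK-NEAR-DATA,
INBOX 31737: a demoted layer of `Ω_k` carries ε₀-size tautological data at near distance); after the plan's (C)-road (ii)-edition of `B15DeterminingSets.bondsOf` the plain meet suffices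
(`DomainsRefinement.ker_QE_le_of_domainsLe` ∘ `domainsMeet_le_right`).  This file is keyed on the PLAIN meet only.

WHAT IS PROVED (sorry-free; axioms standard; no definition; every `Params`).
§1 `meet_cube_domainsOfSeq_k` (height `k`); ★ `cube_Om_subset_domainsOfSeq_Om` ∕ ★ `hbelow_meet` (`hwin : ∀ 1 ≤ i < k, ∀ x, (cubeDomains …).InOm i x → x ∈ Ω i` ⇒ the meet contains — indeed
   agrees with — the cube tower at the levels `1 ≤ i < k`; = the `hbelow` of p615101 `level_succ_eq_of_near_below` ∕ `near_cases`); ★ `inOm_top_meet_of_mem_box` (non-wrapping tower, `1 ≤ k`,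
   `Ω` decreasing + saturated, `π(□) ⊆ Ω_k` ⇒ every point of `π(□)` lies in the meet's top domain `□_k ∩ Ω_k`).
§2 ★★★ `letters10On_HB_meetCube_box_of_centred (F N)` — the `HB` door of (165) at `D″ := domainsMeet (cubeDomains (F.P K) a M ρ (K − n) hk) (domainsOfSeq Ω (K − n) hk)` with the near class
   «`j(c) = K − n ∨ blockOf c₋ ∈ □_{j(c)+1}^{(j(c)+1)}`» (its complement `ρ`-far by p615101): `Adm22 D″ R (L·M_h)` a hypothesis, level weights at `D″`, near data CENTRED at `x_c ∈ □` at every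
   near cell, far data `β₂·(ρ + M)`, `8CB₃e^{−δ₁ρ} ≤ θ` ⇒ `Letters10On (π '' □) η_{K−n} t (H_V B)` for every `t > ¼·M·max{4CB₃β₁, θ·β₂}`.
HONEST SCOPE: compositions by name + finite-set bookkeeping; `Adm22 D″` (dag-n07-w6), `hwin`∕`hbox` (the HEAD's placement: «□̃ ⊆ Ω_{k−1}», «□ ⊆ Ω_k», aligned grids), the DATA (BRIDGE-92),
the kernel formula and the `ker Q_{D″} ⊆ T_fibre` transfer (S4 ∕ plan's (C) road) are NOT here; nothing of [15]∕[6]∕[B6-II] asserted; `stub_prop8StepCoP13` ∕ K0⁷ NOT closed; N07 NOT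
discharged (5∕27 unmoved); one finite 𝕋⁴ programme at fixed ε — R4 closes the conditional finite-𝕋⁴ rung `BalabanLadder.UV` ONLY; the YM mass gap (Clay) is NOT proved by any of this; nothing
continuum ∕ ℝ⁴ ∕ OS.  No `def`, no `instance`, no `notation`, no `sorry`.

References: T. Bałaban, CMP **102** (1985) 277–309 [Balaban1985Variational] (144) p.300, (147)–(150) p.301, (160)–(161) p.303, (163)–(165) p.304; CMP **119** (1988) 243–285
[Balaban1988Convergent] (2.1)–(2.2) p.254; CMP **96** (1984) 223–250 [Balaban1984PropagatorsII] (2.1)–(2.3) p.224.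
-/

set_option autoImplicit false

noncomputable section

open scoped BigOperators Matrix.Norms.L2Operator

namespace Summit.QuantumFields.YangMills.Theorems.K0S5MeetFamilyJunction

open Literature.MathematicalPhysics.QuantumFieldTheory.Balaban1983to89
open Literature.MathematicalPhysics.QuantumFieldTheory.Balaban1983to89.Node00
open B15Eq112TorusCover (cover)
open B14DomainGeom (Pt)
open B5Eq117TorusCarriers (Mk)
open B5Eq118OneStroke (iterBlockOf)
open B5Prop12FieldsLattice (distSite)
open B6SectADomainsV1 (Domains)
open B6SectAOperatorsV1 (BondIdx)
open B8Eq131Cubes (box cube)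
open T4Continuum (T4Family)
open Summit.QuantumFields.YangMills.Theorems.FlatCubeOpsText (Adm22 distBI)
open Summit.QuantumFields.YangMills.Theorems.K0FlatCubeOpsTextP (IsLevWeight flatH)
open Summit.QuantumFields.YangMills.Theorems.K0S5CollarMeetFamily (hcollar_of_not_near)
open Summit.QuantumFields.YangMills.Theorems.K0S5NearCentredAnyLevel (letters10On_HB_boxWindow_of_centred_nearClassW)
open Summit.QuantumFields.YangMills.BalabanUVNodes.N07CubeDomainsAdm22 (inOm_top_cubeDomains_of_mem_box)
open Summit.QuantumFields.YangMills.BalabanUVNodes.N07HalvingStepTopOfLocalLetters (Letters10On)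

variable {P : Params} {a : Pt P.d} {M ρ k : ℕ} {hk : k ≤ P.m + P.K}

/-! ## §1  Print's (150) family as the meet: height, the lower cubes inside the record, the window over the top domain -/

/-- The meet of the cube tower with the record's family has height `k`. [cite: Balaban1985Variational, (150) p.301 (bookkeeping)] -/
theorem meet_cube_domainsOfSeq_k (Ω : ℕ → Set (Site P 0)) :
    (domainsMeet (cubeDomains P a M ρ k hk) (domainsOfSeq Ω k hk)).k = k := by
  rw [domainsMeet_k, cubeDomains_k, domainsOfSeq_k, min_self]

/-- ★ **THE LOWER CUBES LIE IN THE RECORD's REGIONS** (print: «□̃ ⊂ B^{j−1}(Λ_{j−1}) ∪ B^j(Λ_j) ⊂ Ω_{j−1}», p.300, hence `□_i ⊆ □̃ ⊆ Ω_{k−1} ⊆ Ω_i` for `i < k`): if the fine region of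
every lower cube `□_i` (`1 ≤ i < k`) of the tower lies in `Ω_i` (`hwin` — the HEAD's collar «□̃ ⊆ Ω_{k−1}» + the decreasing sequence), then `□_i^{(i)} ⊆ Ω_i^{(i)}` of `domainsOfSeq Ω k` for every `i < k`
(whose level-`i` region asks every fine site of the block to lie in `Ω_{i′}` for all `1 ≤ i′ ≤ i` — supplied along the cube tower's own nesting `InOm i ⇒ InOm i′`).
[cite: Balaban1985Variational, (144) p.300, (150) p.301; Balaban1988Convergent, (2.1)–(2.2) p.254] -/
theorem cube_Om_subset_domainsOfSeq_Om (Ω : ℕ → Set (Site P 0))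
    (hwin : ∀ i, 1 ≤ i → i < k → ∀ x : Site P 0, (cubeDomains P a M ρ k hk).InOm i x → x ∈ Ω i)
    {i : ℕ} (hik : i < k) :
    (cubeDomains P a M ρ k hk).Om i ⊆ (domainsOfSeq Ω k hk).Om i := by
  intro y hy
  rw [mem_domainsOfSeq_Om_iff Ω hk hik.le]
  intro x hx i' hi'1 hi'i
  have hIn : (cubeDomains P a M ρ k hk).InOm i x := by
    show iterBlockOf i x ∈ (cubeDomains P a M ρ k hk).Om i
    rw [hx]
    exact hy
  exact hwin i' hi'1 (lt_of_le_of_lt hi'i hik) x ((cubeDomains P a M ρ k hk).inOm_of_le hi'i hIn)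

/-- ★ **`hbelow` OF `K0S5CollarMeetFamily` AT THE MEET**: under `hwin` the meet `cubeDomains ⊓ domainsOfSeq Ω k` CONTAINS the cube tower at the levels `1 ≤ i < k` (indeed agrees with it there).
[cite: Balaban1985Variational, (150) p.301] -/
theorem hbelow_meet (Ω : ℕ → Set (Site P 0))
    (hwin : ∀ i, 1 ≤ i → i < k → ∀ x : Site P 0, (cubeDomains P a M ρ k hk).InOm i x → x ∈ Ω i) :
    ∀ i, 1 ≤ i → i < k → (cubeDomains P a M ρ k hk).Om i ⊆ (domainsMeet (cubeDomains P a M ρ k hk) (domainsOfSeq Ω k hk)).Om i := by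
  intro i _ hik y hy
  rw [mem_domainsMeet_Om]
  exact ⟨hy, cube_Om_subset_domainsOfSeq_Om Ω hwin hik hy⟩

/-- ★ **THE WINDOW LIES OVER THE MEET's TOP DOMAIN `□_k ∩ Ω_k`** (`hY` of the doors): for a non-wrapping tower (`hinj`), `1 ≤ k`, a decreasing saturated sequence `Ω`, and a window box whose
cover lies in `Ω_k` (`hbox` — the HEAD's placement: aligned grids, «□ meets Ω_k ⇒ □ ⊆ Ω_k»): every point of `π(□)` is in `Ω″_k = B^k(□_k^{(k)} ∩ Ω_k^{(k)})`.
[cite: Balaban1985Variational, (150) p.301 («Ω′_k = □″_k»), p.302 («we take □ as this big cube»)] -/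
theorem inOm_top_meet_of_mem_box (Ω : ℕ → Set (Site P 0)) (hinj : Set.InjOn (cover P) (cube P.L a M ρ k 0)) (hk1 : 1 ≤ k)
    (hnest : ∀ i : ℕ, 1 ≤ i → i < k → Ω (i + 1) ⊆ Ω i)
    (hsat : ∀ (j : ℕ) (x x' : Site P 0), 1 ≤ j → j ≤ k → iterBlockOf j x = iterBlockOf j x' → x ∈ Ω j → x' ∈ Ω j)
    (hbox : ∀ x ∈ box P.L a M k, cover P x ∈ Ω k) :
    ∀ z ∈ cover P '' box P.L a M k, (domainsMeet (cubeDomains P a M ρ k hk) (domainsOfSeq Ω k hk)).InOm k z := by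
  rintro _ ⟨x, hx, rfl⟩
  show iterBlockOf k (cover P x) ∈ (domainsMeet (cubeDomains P a M ρ k hk) (domainsOfSeq Ω k hk)).Om k
  rw [mem_domainsMeet_Om]
  exact ⟨inOm_top_cubeDomains_of_mem_box hinj hk1 hx, (inOm_domainsOfSeq_iff Ω hk hnest hsat hk1 le_rfl _).2 (hbox x hx)⟩

/-! ## §2  The `HB` door at a boundary datum, keyed on the meet family (FILE 5 §3 ∘ p615101 `hcollar_of_not_near` ∘ §1) -/

open scoped Classical in
/-- ★★★ **THE `HB`-LETTERS OF (165) ON THE GRID CUBE OF A PRINT DATUM AT PRINT's (150) FAMILY `Ω′_j = □_j ∩ Ω_j`** (the boundary-datum twin of dag-n07-w4's `letters10On_HB_cubeDomains_box_of_centred`):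
at `D″ := domainsMeet (cubeDomains (F.P K) a M ρ (K − n) hk) (domainsOfSeq Ω (K − n) hk)` — `Ω` the record's decreasing, saturated sequence of fine regions (`s.Ω`), the window box `□` with
`π(□) ⊆ Ω_{K−n}` (`hbox`), non-wrapping tower — and with the near class «top level, or source block in the next cube» (whose complement is `ρ`-far: p615101), every `Adm22 D″ R (L·M_h)`
(dag-n07-w6's `adm22_meet_domainsOfSeq_seqOfRecord`, a HYPOTHESIS here), every level-weight family at `D″`, near data CENTRED `‖B c‖ ≤ β₁·(dist_{j(c)}(c₋, B^{j(c)}(π x_c)) + 1)`, far data UNIFORM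
`‖B c‖ ≤ β₂·(ρ + M)`, `8CB₃e^{−δ₁ρ} ≤ θ`: `Letters10On (π '' □) η_{K−n} t (H_V B)` for every `t > ¼·M·max{4CB₃β₁, θ·β₂}`.
[cite: Balaban1985Variational, (144) p.300, (147)–(150) p.301, (155) p.302, (160)–(161) p.303, (163)–(165) p.304; Balaban1984PropagatorsII, (2.1)–(2.2) p.224] -/
theorem letters10On_HB_meetCube_box_of_centred (F : T4Family) (N : ℕ) [NeZero N] :
    ∃ (Mh₀ R₀ : ℕ) (C δ₀ δ₁ B₃ : ℝ), 0 ≤ C ∧ 0 < δ₀ ∧ 0 < δ₁ ∧ 0 < B₃ ∧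
    ∀ (n K : ℕ) (hk1 : 1 ≤ K - n) (_ : K - n + 1 ≤ F.m + K) (hk : K - n ≤ (F.P K).m + (F.P K).K)
      {Mh R a' : ℕ} (_ : Mh = F.L ^ a') (_ : Mh₀ ≤ Mh) (_ : R₀ ≤ R) (_ : a' + 3 ≤ F.m + n)
      {a : Pt (F.P K).d} {M ρ : ℕ} (_ : 1 ≤ M) (_ : Set.InjOn (cover (F.P K)) (cube (F.P K).L a M ρ (K - n) 0))
      (Ω : ℕ → Set (Site (F.P K) 0)) (_ : ∀ i : ℕ, 1 ≤ i → i < K - n → Ω (i + 1) ⊆ Ω i)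
      (_ : ∀ (j : ℕ) (x x' : Site (F.P K) 0), 1 ≤ j → j ≤ K - n → iterBlockOf j x = iterBlockOf j x' → x ∈ Ω j → x' ∈ Ω j)
      (_ : ∀ x ∈ box (F.P K).L a M (K - n), cover (F.P K) x ∈ Ω (K - n))
      (_ : Adm22 (domainsMeet (cubeDomains (F.P K) a M ρ (K - n) hk) (domainsOfSeq Ω (K - n) hk)) R (F.L * Mh))
      (w : ℕ → PBond (F.P K) 0 → ℝ) (_ : IsLevWeight (F.P K) (K - n) (domainsMeet (cubeDomains (F.P K) a M ρ (K - n) hk) (domainsOfSeq Ω (K - n) hk)) w)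
      {xc : Pt (F.P K).d} (_ : xc ∈ box (F.P K).L a M (K - n))
      {β₁ β₂ θ : ℝ} (_ : 0 ≤ β₁) (_ : 0 ≤ β₂) (_ : 8 * C * B₃ * Real.exp (-(δ₁ * (ρ : ℝ))) ≤ θ)
      {HV : (BondIdx (domainsMeet (cubeDomains (F.P K) a M ρ (K - n) hk) (domainsOfSeq Ω (K - n) hk)) → MatA N) →ₗ[ℂ] (PBond (F.P K) 0 → MatA N)}
      (_ : ∀ (A : BondIdx (domainsMeet (cubeDomains (F.P K) a M ρ (K - n) hk) (domainsOfSeq Ω (K - n) hk)) → MatA N) (b : PBond (F.P K) 0),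
        HV A b = ∑ c, ((flatH (F.P K) (K - n) (domainsMeet (cubeDomains (F.P K) a M ρ (K - n) hk) (domainsOfSeq Ω (K - n) hk)) (Pi.single c 1) b : ℝ) : ℂ) • A c)
      {B : BondIdx (domainsMeet (cubeDomains (F.P K) a M ρ (K - n) hk) (domainsOfSeq Ω (K - n) hk)) → MatA N}
      (_ : ∀ c : BondIdx (domainsMeet (cubeDomains (F.P K) a M ρ (K - n) hk) (domainsOfSeq Ω (K - n) hk)),
        ((c.1.1 : ℕ) = K - n ∨ blockOf c.1.2.src ∈ (cubeDomains (F.P K) a M ρ (K - n) hk).Om ((c.1.1 : ℕ) + 1)) →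
          ‖B c‖ ≤ β₁ * (distSite (Mk (F.P K) (c.1.1 : ℕ)) c.1.2.src (iterBlockOf (c.1.1 : ℕ) (cover (F.P K) xc)) + 1))
      (_ : ∀ c : BondIdx (domainsMeet (cubeDomains (F.P K) a M ρ (K - n) hk) (domainsOfSeq Ω (K - n) hk)),
        ¬ ((c.1.1 : ℕ) = K - n ∨ blockOf c.1.2.src ∈ (cubeDomains (F.P K) a M ρ (K - n) hk).Om ((c.1.1 : ℕ) + 1)) → ‖B c‖ ≤ β₂ * ((ρ : ℝ) + M))
      {t : ℝ} (_ : 1 / 4 * (M : ℝ) * max (4 * C * B₃ * β₁) (θ * β₂) < t),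
      Letters10On (cover (F.P K) '' box (F.P K).L a M (K - n)) ((F.P K).eta (K - n)) t (HV B) := by
  obtain ⟨Mh₀, R₀, C, δ₀, δ₁, B₃, hC, hδ₀, hδ₁, hB₃, hmain⟩ := letters10On_HB_boxWindow_of_centred_nearClassW F N
  refine ⟨Mh₀, R₀, C, δ₀, δ₁, B₃, hC, hδ₀, hδ₁, hB₃, ?_⟩
  intro n K hk1 hk' hk Mh R a' hMha hMh hR hsize a M ρ hM hinj Ω hnest hsat hbox hAdm w hw xc hxc β₁ β₂ θ hβ₁ hβ₂ h163 HV hHv B hX₁ hX₂ t ht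
  have hDk : (domainsMeet (cubeDomains (F.P K) a M ρ (K - n) hk) (domainsOfSeq Ω (K - n) hk)).k = K - n := meet_cube_domainsOfSeq_k Ω
  exact hmain n K hk1 hk' hMha hMh hR hsize _ hDk hAdm w hw hM (inOm_top_meet_of_mem_box Ω hinj hk1 hnest hsat hbox) hxc _
    (hcollar_of_not_near hDk) hβ₁ hβ₂ h163 hHv hX₁ hX₂ ht

end Summit.QuantumFields.YangMills.Theorems.K0S5MeetFamilyJunction

end
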